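import Summits.QuantumFields.YangMills.Theorems.AllWindowsColdBoxProjKernelGaugeChange
import Summits.QuantumFields.YangMills.Theorems.WeakCouplingRatesColdBoxDirichletPosDef
import Summits.QuantumFields.YangMills.Theorems.WeakCouplingRatesColdBoxIndex

/-!
# The forest-gauge Dirichlet projection kernel is the Hodge (Landau) kernel — concrete gauge change for the cold box
# (K1 plan step (a) of LINE-18 v5 on crux `BulkMidWindowSU2`, stmt-QuantumFields-24006; Prop `DirProjKernelHodgeForm` = stub S2 of the
# draft Landau line of planner ym-idea-2 g15, HOME ideators/ym-idea-2/l23/{Sketch,line-landau}.lean)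

The tree's Dirichlet projection kernel `boxDirProjKernel H p q = λ^D_p · Q_D⁻¹ λ^D_q` (`WeakCouplingRatesDefs`) lives on the free edges
`DirFree H` of the TEMPORAL-FOREST gauge: edges of the cold box `Λ = boxEdges 4 (2H+1)` off the forest `{(x, e₀) : x interior}`.  This file
instantiates the abstract gauge change `GaugeChange.dotProduct_inv_restrict_eq_dotProduct_inv_hodge` (file `…ProjKernelGaugeChange`) to it:
with the LANDAU pinning `pinL = (· ∉ Λ)` (all box edges free, no forest), the gauge modes `g_x = d δ_x` of the interior sites `x` (all
coordinates in `[1, 2H−1]`) and the Hodge precision matrix `Q_H = Qmat pinL dirCorner (2H+3) + Σ_{x interior} g_x g_xᵀ`,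

  `boxDirProjKernel H p q = coeff pinL dirCorner (2H+3) p ⬝ᵥ (Q_H⁻¹ *ᵥ coeff pinL dirCorner (2H+3) q)`   (`boxDirProjKernel_eq_hodgeForm`)

for ALL `H, p, q`, and `Q_H` is positive definite (`hodgeForm_posDef`).  The two inputs of the abstract lemma are checked here:
* CURL-FREENESS `coeff pinL r ⬝ᵥ g_x = 0` (`coeff_dotProduct_grad_eq_zero`): the glued edge function of `g_x` is the full lattice gradient
  `d δ_x` (an interior site has all its 8 edges in `Λ`, `mem_boxEdges_of_endpoint`), and the circulation of a gradient vanishes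
  (`sCirc_gradient_eq_zero`);
* FOREST DECOMPOSITION `u = ext w + Σ_x φ_x g_x` (inside the main proof): `φ(x) = −Σ_{forest edges e on the temporal line of x, at or above x} u_e`
  telescopes to `u` on every forest edge (`forest_telescope`), and `w` collects what is left on the free edges.
The statement is GENERIC in the presentation of the Landau objects (any `pinL ↔ (· ∉ Λ)`, any finset `I ↔ interior`, any `g` with the
gradient formula), so the planner's `landauPin / interiorSites / gradVec / hodgeQ / landauCoeff` (l23/Sketch.lean) instantiate it by
`boxDirProjKernel_eq_hodgeForm H (landauPin H) (fun _ => Iff.rfl) (interiorSites H) hI (gradVec H) (fun _ _ => rfl) p q` with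
`hI : ∀ x, x ∈ interiorSites H ↔ ∀ k, 1 ≤ x k ∧ x k + 1 ≤ 2H` (`by simp only [interiorSites, Fintype.mem_piFinset, Finset.mem_Icc]; exact
forall_congr' fun k => by omega`) — COMPAT CHECKED (lean rc 0) against a verbatim copy of those definitions: it yields `DirProjKernelHodgeForm`
(for every `H`, the hypothesis `1 ≤ H` is not needed) and `(hodgeQ H).PosDef`.  No definition is introduced.  HONEST LABEL: linear-algebra/combinatorics helper for the open stub K1 of a critic-passed line on the R2ξ″
RECORD-rung crux 24006 (and for an unregistered draft line on 24004); no stub of a registered skeleton is proved by name, no crux, rung or summit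
is proved; the Yang–Mills mass gap is NOT proved by this.
-/

set_option autoImplicit false

open Matrix Finset
open scoped Matrix
open Literature.Probability.LatticeModels (Site mem_halfOpenBox halfOpenBox)
open Literature.MathematicalPhysics.QuantumFieldTheory
open Literature.MathematicalPhysics.QuantumFieldTheory.LatticeMaxwell
open Literature.MathematicalPhysics.QuantumFieldTheory.AxialGauge

namespace Summit.QuantumFields.YangMills.Theorems.AllWindowsColdBox.HodgeForm

open Summit.QuantumFields.YangMills.Theorems.WeakCouplingRates
open Summit.QuantumFields.YangMills.Theorems.AllWindowsColdBox.GaugeChange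

/-! ## Generic pieces -/

/-- The precision matrix re-indexed by the plaquettes of `ℤ^d` themselves (translation is injective). -/
theorem Qmat_eq_sum_image {d : ℕ} (pin : Literature.MathematicalPhysics.QuantumLattice.ZdEdge d → Prop) [DecidablePred pin] (a : Site d) (n : ℕ) :
    Qmat pin a n = ∑ r ∈ (plaquettesIn (halfOpenBox d n)).image (Plaq.shift a),
      vecMulVec (coeff pin a n r) (coeff pin a n r) := by
  rw [Qmat, Finset.sum_image (Plaq.shift_injective a).injOn]

/-- The circulation of a lattice gradient `e ↦ ψ(x + e_i) − ψ(x)` around any plaquette vanishes (`d₁ ∘ d₀ = 0`). -/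
theorem sCirc_gradient_eq_zero {d : ℕ} (ψ : Site d → ℝ) (r : Plaq d) :
    sCirc (fun e : Literature.MathematicalPhysics.QuantumLattice.ZdEdge d => ψ (e.1 + Pi.single e.2 1) - ψ e.1) r = 0 := by
  simp only [sCirc]
  rw [add_right_comm r.1 (Pi.single r.2.2 (1 : ℤ)) (Pi.single r.2.1 (1 : ℤ))]
  ring

/-- An edge of `ℤ⁴` with an endpoint at an interior site of the cold box (all coordinates in `[1, 2H−1]`) is an edge of the cold box. -/
theorem mem_boxEdges_of_endpoint {H : ℕ} {x : Site 4} (hx : ∀ k : Fin 4, 1 ≤ x k ∧ x k + 1 ≤ 2 * (H : ℤ))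
    {e : Literature.MathematicalPhysics.QuantumLattice.ZdEdge 4} (he : e.1 + Pi.single e.2 1 = x ∨ e.1 = x) : e ∈ boxEdges 4 (2 * H + 1) := by
  obtain ⟨y, i⟩ := e
  rw [mem_boxEdges_iff]
  rcases he with h | h
  · have hy : ∀ k, y k = x k - (Pi.single i (1 : ℤ) : Fin 4 → ℤ) k := fun k => by
      have := congrFun h k
      simp only [Pi.add_apply] at this
      linarith
    refine ⟨fun k => ?_, ?_⟩
    · rw [hy k]
      have := hx k
      by_cases hk : k = i
      · subst hk; simp only [Pi.single_eq_same]; push_cast; omega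
      · simp only [Pi.single_eq_of_ne hk]; push_cast; omega
    · rw [hy i]
      have := hx i
      simp only [Pi.single_eq_same]; push_cast; omega
  · simp only at h
    subst h
    refine ⟨fun k => ?_, ?_⟩
    · have := hx k; push_cast; omega
    · have := hx i; push_cast; omega

/-! ## The Landau presentation: curl-freeness of the gauge modes -/

section Landau

variable {H : ℕ} {pinL : Literature.MathematicalPhysics.QuantumLattice.ZdEdge 4 → Prop} [DecidablePred pinL]

/-- The glued edge function of the gauge mode `g_x` of an interior site `x` is the full lattice gradient of `δ_x`. -/
theorem glue_zero_grad_eq (hpinL : ∀ e, pinL e ↔ e ∉ boxEdges 4 (2 * H + 1)) {x : Site 4}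
    (hx : ∀ k : Fin 4, 1 ≤ x k ∧ x k + 1 ≤ 2 * (H : ℤ)) (gx : Free pinL dirCorner (2 * H + 3) → ℝ)
    (hgx : ∀ e, gx e = (if e.1.1.1 + Pi.single e.1.1.2 1 = x then (1 : ℝ) else 0) - (if e.1.1.1 = x then (1 : ℝ) else 0))
    (e : Literature.MathematicalPhysics.QuantumLattice.ZdEdge 4) :
    glue dirCorner (2 * H + 3) (0 : Literature.MathematicalPhysics.QuantumLattice.ZdEdge 4 → ℝ) gx e =
      (if e.1 + Pi.single e.2 1 = x then (1 : ℝ) else 0) - (if e.1 = x then (1 : ℝ) else 0) := by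
  by_cases hmem : e ∈ boxEdgesAt dirCorner (2 * H + 3)
  · by_cases hp : pinL e
    · have hΛ : e ∉ boxEdges 4 (2 * H + 1) := (hpinL e).1 hp
      have h1 : ¬ (e.1 + Pi.single e.2 1 = x) := fun h => hΛ (mem_boxEdges_of_endpoint hx (Or.inl h))
      have h2 : ¬ (e.1 = x) := fun h => hΛ (mem_boxEdges_of_endpoint hx (Or.inr h))
      rw [glue_apply_pin _ _ hmem hp, Pi.zero_apply, if_neg h1, if_neg h2, sub_zero]
    · have := glue_apply_free (0 : Literature.MathematicalPhysics.QuantumLattice.ZdEdge 4 → ℝ) gx ⟨⟨e, hmem⟩, hp⟩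
      exact this.trans (hgx _)
  · have hΛ : e ∉ boxEdges 4 (2 * H + 1) := fun h => hmem (boxEdges_subset_boxEdgesAt_dirCorner H h)
    have h1 : ¬ (e.1 + Pi.single e.2 1 = x) := fun h => hΛ (mem_boxEdges_of_endpoint hx (Or.inl h))
    have h2 : ¬ (e.1 = x) := fun h => hΛ (mem_boxEdges_of_endpoint hx (Or.inr h))
    rw [glue_apply_of_not_mem _ _ hmem, if_neg h1, if_neg h2, sub_zero]

/-- **Curl-freeness of the gauge modes**: `λ_r · g_x = 0` for every plaquette `r` and every interior site `x`. -/
theorem coeff_dotProduct_grad_eq_zero (hpinL : ∀ e, pinL e ↔ e ∉ boxEdges 4 (2 * H + 1)) {x : Site 4}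
    (hx : ∀ k : Fin 4, 1 ≤ x k ∧ x k + 1 ≤ 2 * (H : ℤ)) (gx : Free pinL dirCorner (2 * H + 3) → ℝ)
    (hgx : ∀ e, gx e = (if e.1.1.1 + Pi.single e.1.1.2 1 = x then (1 : ℝ) else 0) - (if e.1.1.1 = x then (1 : ℝ) else 0))
    (r : Plaq 4) : coeff pinL dirCorner (2 * H + 3) r ⬝ᵥ gx = 0 := by
  have h1 : coeff pinL dirCorner (2 * H + 3) r ⬝ᵥ gx = sCirc (glue dirCorner (2 * H + 3) (0 : Literature.MathematicalPhysics.QuantumLattice.ZdEdge 4 → ℝ) gx) r := by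
    rw [sCirc_glue, bterm]
    have : sCirc (glue (pin := pinL) dirCorner (2 * H + 3) (0 : Literature.MathematicalPhysics.QuantumLattice.ZdEdge 4 → ℝ)
        (0 : Free pinL dirCorner (2 * H + 3) → ℝ)) r = 0 := by
      simp [sCirc, glue_zero_eq_sum]
    rw [this, add_zero]
  have h2 : glue dirCorner (2 * H + 3) (0 : Literature.MathematicalPhysics.QuantumLattice.ZdEdge 4 → ℝ) gx =
      fun e : Literature.MathematicalPhysics.QuantumLattice.ZdEdge 4 => (fun z : Site 4 => if z = x then (1 : ℝ) else 0) (e.1 + Pi.single e.2 1) -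
        (fun z : Site 4 => if z = x then (1 : ℝ) else 0) e.1 := by
    funext e
    exact glue_zero_grad_eq hpinL hx gx hgx e
  rw [h1, h2]
  exact sCirc_gradient_eq_zero (fun z : Site 4 => if z = x then (1 : ℝ) else 0) r

/-! ## The Landau presentation: the forest decomposition (telescoping along interior temporal lines) -/

omit [DecidablePred pinL] in
/-- The gauge part `Σ_x φ_x g_x` evaluated on an edge: `φ̃(head) − φ̃(tail)` with `φ̃ = φ · 𝟙_I`. -/
theorem sum_smul_grad_apply (I : Finset (Site 4)) (φ : Site 4 → ℝ) (g : Site 4 → Free pinL dirCorner (2 * H + 3) → ℝ)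
    (hg : ∀ x e, g x e = (if e.1.1.1 + Pi.single e.1.1.2 1 = x then (1 : ℝ) else 0) - (if e.1.1.1 = x then (1 : ℝ) else 0))
    (e : Free pinL dirCorner (2 * H + 3)) :
    (∑ s : ↥I, φ s.1 • g s.1) e =
      (if e.1.1.1 + Pi.single e.1.1.2 1 ∈ I then φ (e.1.1.1 + Pi.single e.1.1.2 1) else 0) -
        (if e.1.1.1 ∈ I then φ e.1.1.1 else 0) := by
  have key : ∀ z : Site 4, (∑ s : ↥I, φ s.1 * (if z = s.1 then (1 : ℝ) else 0)) = if z ∈ I then φ z else 0 := by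
    intro z
    by_cases hz : z ∈ I
    · rw [if_pos hz, Finset.sum_eq_single (⟨z, hz⟩ : ↥I)]
      · simp
      · intro s _ hs
        rw [if_neg, mul_zero]
        intro h; exact hs (Subtype.ext h.symm)
      · intro h; exact absurd (Finset.mem_univ _) h
    · rw [if_neg hz]
      refine Finset.sum_eq_zero fun s _ => ?_
      rw [if_neg, mul_zero]
      intro h; exact hz (h ▸ s.2)
  rw [Finset.sum_apply]
  simp only [Pi.smul_apply, smul_eq_mul, hg, mul_sub, Finset.sum_sub_distrib]
  rw [key, key]

/-- **Telescoping.**  With `φ(z) = −Σ_{e' temporal, base interior, same spatial coordinates as z, time ≥ z₀} u_{e'}`, the gauge part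
reproduces `u` on every forest edge `e = (x, e₀)`, `x` interior: `φ̃(x + e₀) − φ̃(x) = u_e`. -/
theorem forest_telescope (I : Finset (Site 4)) (hI : ∀ x, x ∈ I ↔ ∀ k : Fin 4, 1 ≤ x k ∧ x k + 1 ≤ 2 * (H : ℤ))
    (u : Free pinL dirCorner (2 * H + 3) → ℝ) (φ : Site 4 → ℝ)
    (hφ : ∀ z, φ z = - ∑ e' : Free pinL dirCorner (2 * H + 3),
      (if e'.1.1.2 = 0 ∧ (∀ k : Fin 4, k ≠ 0 → e'.1.1.1 k = z k) ∧ z 0 ≤ e'.1.1.1 0 ∧ e'.1.1.1 ∈ I then u e' else 0))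
    (e : Free pinL dirCorner (2 * H + 3)) (he0 : e.1.1.2 = 0) (heI : e.1.1.1 ∈ I) :
    (if e.1.1.1 + Pi.single e.1.1.2 1 ∈ I then φ (e.1.1.1 + Pi.single e.1.1.2 1) else 0) -
        (if e.1.1.1 ∈ I then φ e.1.1.1 else 0) = u e := by
  rw [if_pos heI, he0]
  have hx := (hI e.1.1.1).1 heI
  -- the head term is `φ (x + e₀)` in both cases (if `x + e₀` is not interior, the defining sum is empty)
  have hhead : (if e.1.1.1 + Pi.single (0 : Fin 4) (1 : ℤ) ∈ I then φ (e.1.1.1 + Pi.single 0 1) else 0) =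
      φ (e.1.1.1 + Pi.single 0 1) := by
    by_cases hxI : e.1.1.1 + Pi.single (0 : Fin 4) (1 : ℤ) ∈ I
    · rw [if_pos hxI]
    · rw [if_neg hxI, hφ, eq_comm, neg_eq_zero]
      refine Finset.sum_eq_zero fun e' _ => ?_
      rw [if_neg]
      rintro ⟨_, hsp, ht, hI'⟩
      apply hxI
      rw [hI]
      have hI'' := (hI _).1 hI'
      intro k
      by_cases hk : k = 0
      · subst hk
        simp only [Pi.add_apply, Pi.single_eq_same] at ht ⊢
        have := hI'' 0; have := hx 0; omega
      · simp only [Pi.add_apply, Pi.single_eq_of_ne hk, add_zero]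
        exact hx k
  rw [hhead, hφ, hφ, neg_sub_neg, ← Finset.sum_sub_distrib, Finset.sum_eq_single e]
  · rw [if_pos ⟨he0, fun k _ => rfl, le_rfl, heI⟩, if_neg, sub_zero]
    rintro ⟨_, _, ht, _⟩
    simp only [Pi.add_apply, Pi.single_eq_same] at ht
    omega
  · intro e' _ hne
    by_cases hT : e'.1.1.2 = 0 ∧ (∀ k : Fin 4, k ≠ 0 → e'.1.1.1 k = e.1.1.1 k) ∧ e.1.1.1 0 ≤ e'.1.1.1 0 ∧ e'.1.1.1 ∈ I
    · obtain ⟨h0, hsp, ht, hI'⟩ := hT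
      rw [if_pos ⟨h0, hsp, ht, hI'⟩, if_pos, sub_self]
      refine ⟨h0, fun k hk => ?_, ?_, hI'⟩
      · simp only [Pi.add_apply, Pi.single_eq_of_ne hk, add_zero]
        exact hsp k hk
      · simp only [Pi.add_apply, Pi.single_eq_same]
        rcases lt_or_eq_of_le ht with hlt | heq
        · omega
        · exfalso
          apply hne
          apply Subtype.ext; apply Subtype.ext
          refine Prod.ext ?_ (h0.trans he0.symm)
          funext k
          by_cases hk : k = 0
          · subst hk; exact heq.symm
          · exact hsp k hk
    · rw [if_neg hT, if_neg, sub_zero]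
      rintro ⟨h0, hsp, ht, hI'⟩
      apply hT
      refine ⟨h0, fun k hk => ?_, ?_, hI'⟩
      · have := hsp k hk
        simp only [Pi.add_apply, Pi.single_eq_of_ne hk, add_zero] at this
        exact this
      · simp only [Pi.add_apply, Pi.single_eq_same] at ht
        omega
  · intro h; exact absurd (Finset.mem_univ e) h

/-! ## The gauge change for the cold box -/

/-- **Hodge form of the Dirichlet projection kernel, and positivity of the Hodge matrix** (both from the abstract gauge change). -/
theorem hodgeForm_posDef_and_kernel_eq (H : ℕ) (pinL : Literature.MathematicalPhysics.QuantumLattice.ZdEdge 4 → Prop) [DecidablePred pinL]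
    (hpinL : ∀ e, pinL e ↔ e ∉ boxEdges 4 (2 * H + 1))
    (I : Finset (Site 4)) (hI : ∀ x, x ∈ I ↔ ∀ k : Fin 4, 1 ≤ x k ∧ x k + 1 ≤ 2 * (H : ℤ))
    (g : Site 4 → Free pinL dirCorner (2 * H + 3) → ℝ)
    (hg : ∀ x e, g x e = (if e.1.1.1 + Pi.single e.1.1.2 1 = x then (1 : ℝ) else 0) - (if e.1.1.1 = x then (1 : ℝ) else 0)) :
    (Qmat pinL dirCorner (2 * H + 3) + ∑ x ∈ I, vecMulVec (g x) (g x)).PosDef ∧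
      ∀ p q : Plaq 4, boxDirProjKernel H p q =
        coeff pinL dirCorner (2 * H + 3) p ⬝ᵥ
          ((Qmat pinL dirCorner (2 * H + 3) + ∑ x ∈ I, vecMulVec (g x) (g x))⁻¹ *ᵥ coeff pinL dirCorner (2 * H + 3) q) := by
  classical
  -- the inclusion of the forest-gauge free edges into the Landau free edges
  obtain ⟨ι, hι⟩ : ∃ ι : DirFree H → Free pinL dirCorner (2 * H + 3), ∀ d, (ι d).1 = d.1 :=
    ⟨fun d => ⟨d.1, fun h => (hpinL d.1.1).1 h (mem_dirFreeEdges.1 (not_not.1 d.2)).1⟩, fun _ => rfl⟩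
  have hιinj : Function.Injective ι := fun d d' h => Subtype.ext (by rw [← hι d, ← hι d', h])
  have hrestrict : ∀ r : Plaq 4, (fun d : DirFree H => coeff pinL dirCorner (2 * H + 3) r (ι d)) =
      coeff (fun e => e ∉ dirFreeEdges H) dirCorner (2 * H + 3) r := by
    intro r; funext d; simp only [coeff, hι]
  have hQD_eq : Qmat (fun e => e ∉ dirFreeEdges H) dirCorner (2 * H + 3) =
      ∑ r ∈ (plaquettesIn (halfOpenBox 4 (2 * H + 3))).image (Plaq.shift dirCorner),
        vecMulVec (fun d : DirFree H => coeff pinL dirCorner (2 * H + 3) r (ι d))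
          (fun d : DirFree H => coeff pinL dirCorner (2 * H + 3) r (ι d)) := by
    rw [Qmat_eq_sum_image]
    exact Finset.sum_congr rfl fun r _ => by rw [← hrestrict r]
  have hQD : (∑ r ∈ (plaquettesIn (halfOpenBox 4 (2 * H + 3))).image (Plaq.shift dirCorner),
      vecMulVec (fun d : DirFree H => coeff pinL dirCorner (2 * H + 3) r (ι d))
        (fun d : DirFree H => coeff pinL dirCorner (2 * H + 3) r (ι d))).PosDef := by
    rw [← hQD_eq]; exact posDef_dirQmat H
  have hcurl : ∀ (r : Plaq 4) (s : ↥I), coeff pinL dirCorner (2 * H + 3) r ⬝ᵥ g s.1 = 0 := fun r s =>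
    coeff_dotProduct_grad_eq_zero hpinL ((hI s.1).1 s.2) (g s.1) (hg s.1) r
  have hdecomp : ∀ u : Free pinL dirCorner (2 * H + 3) → ℝ, ∃ (w : DirFree H → ℝ) (φ : ↥I → ℝ),
      u = (fun e => ∑ d : DirFree H, if ι d = e then w d else 0) + ∑ s : ↥I, φ s • g s.1 := by
    intro u
    -- the gauge function: minus the sum of `u` over the forest edges above a site on its temporal line
    obtain ⟨Φ, hΦ⟩ : ∃ Φ : Site 4 → ℝ, ∀ z, Φ z = - ∑ e' : Free pinL dirCorner (2 * H + 3),
        (if e'.1.1.2 = 0 ∧ (∀ k : Fin 4, k ≠ 0 → e'.1.1.1 k = z k) ∧ z 0 ≤ e'.1.1.1 0 ∧ e'.1.1.1 ∈ I then u e' else 0) :=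
      ⟨_, fun _ => rfl⟩
    refine ⟨fun d => u (ι d) - (∑ s : ↥I, Φ s.1 • g s.1) (ι d), fun s => Φ s.1, ?_⟩
    funext e
    rw [Pi.add_apply]
    by_cases hfree : e.1.1 ∈ dirFreeEdges H
    · have hd0 : ι ⟨e.1, not_not.2 hfree⟩ = e := Subtype.ext (hι _)
      rw [Finset.sum_eq_single (⟨e.1, not_not.2 hfree⟩ : DirFree H), if_pos hd0]
      · beta_reduce
        rw [hd0]
        ring
      · intro d _ hne
        rw [if_neg]
        intro h; exact hne (hιinj (h.trans hd0.symm))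
      · intro h; exact absurd (Finset.mem_univ _) h
    · have hΛ : e.1.1 ∈ boxEdges 4 (2 * H + 1) := by
        by_contra h; exact e.2 ((hpinL _).2 h)
      have hforest : e.1.1.2 = 0 ∧ ∀ k : Fin 4, 1 ≤ e.1.1.1 k ∧ e.1.1.1 k + 1 ≤ 2 * (H : ℤ) := by
        by_contra h; exact hfree (mem_dirFreeEdges.2 ⟨hΛ, h⟩)
      have hzero : (∑ d : DirFree H, if ι d = e then u (ι d) - (∑ s : ↥I, Φ s.1 • g s.1) (ι d) else 0) = 0 := by
        refine Finset.sum_eq_zero fun d _ => ?_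
        rw [if_neg]
        intro h
        apply hfree
        have : e.1.1 = d.1.1 := by rw [← h, hι]
        rw [this]; exact not_not.1 d.2
      rw [hzero, zero_add, sum_smul_grad_apply I Φ g hg e]
      exact (forest_telescope I hI u Φ hΦ e hforest.1 ((hI _).2 hforest.2)).symm
  refine ⟨?_, fun p q => ?_⟩
  · have hpos := hodge_posDef ι ((plaquettesIn (halfOpenBox 4 (2 * H + 3))).image (Plaq.shift dirCorner))
      (coeff pinL dirCorner (2 * H + 3)) (fun s : ↥I => g s.1) hcurl hdecomp hQD
    rw [← Qmat_eq_sum_image, Finset.sum_coe_sort I (fun x => vecMulVec (g x) (g x))] at hpos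
    exact hpos
  · have key := dotProduct_inv_restrict_eq_dotProduct_inv_hodge ι
      ((plaquettesIn (halfOpenBox 4 (2 * H + 3))).image (Plaq.shift dirCorner))
      (coeff pinL dirCorner (2 * H + 3)) (fun s : ↥I => g s.1) hcurl hdecomp hQD p q
    rw [← Qmat_eq_sum_image, Finset.sum_coe_sort I (fun x => vecMulVec (g x) (g x))] at key
    rw [boxDirProjKernel, hQD_eq, ← hrestrict p, ← hrestrict q]
    exact key

/-- **The Hodge (Landau) precision matrix of the cold box is positive definite** (hence invertible). -/
theorem hodgeForm_posDef (H : ℕ) (pinL : Literature.MathematicalPhysics.QuantumLattice.ZdEdge 4 → Prop) [DecidablePred pinL]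
    (hpinL : ∀ e, pinL e ↔ e ∉ boxEdges 4 (2 * H + 1))
    (I : Finset (Site 4)) (hI : ∀ x, x ∈ I ↔ ∀ k : Fin 4, 1 ≤ x k ∧ x k + 1 ≤ 2 * (H : ℤ))
    (g : Site 4 → Free pinL dirCorner (2 * H + 3) → ℝ)
    (hg : ∀ x e, g x e = (if e.1.1.1 + Pi.single e.1.1.2 1 = x then (1 : ℝ) else 0) - (if e.1.1.1 = x then (1 : ℝ) else 0)) :
    (Qmat pinL dirCorner (2 * H + 3) + ∑ x ∈ I, vecMulVec (g x) (g x)).PosDef :=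
  (hodgeForm_posDef_and_kernel_eq H pinL hpinL I hI g hg).1

/-- **Gauge change for the cold box: the forest-gauge Dirichlet projection kernel is the Hodge/Landau kernel**,
`boxDirProjKernel H p q = λ^L_p · (Q_L + Σ_{x interior} g_x g_xᵀ)⁻¹ λ^L_q` for all plaquettes `p, q` (the planner's `DirProjKernelHodgeForm`,
for every `H`). -/
theorem boxDirProjKernel_eq_hodgeForm (H : ℕ) (pinL : Literature.MathematicalPhysics.QuantumLattice.ZdEdge 4 → Prop) [DecidablePred pinL]
    (hpinL : ∀ e, pinL e ↔ e ∉ boxEdges 4 (2 * H + 1))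
    (I : Finset (Site 4)) (hI : ∀ x, x ∈ I ↔ ∀ k : Fin 4, 1 ≤ x k ∧ x k + 1 ≤ 2 * (H : ℤ))
    (g : Site 4 → Free pinL dirCorner (2 * H + 3) → ℝ)
    (hg : ∀ x e, g x e = (if e.1.1.1 + Pi.single e.1.1.2 1 = x then (1 : ℝ) else 0) - (if e.1.1.1 = x then (1 : ℝ) else 0))
    (p q : Plaq 4) :
    boxDirProjKernel H p q =
      coeff pinL dirCorner (2 * H + 3) p ⬝ᵥ
        ((Qmat pinL dirCorner (2 * H + 3) + ∑ x ∈ I, vecMulVec (g x) (g x))⁻¹ *ᵥ coeff pinL dirCorner (2 * H + 3) q) :=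
  (hodgeForm_posDef_and_kernel_eq H pinL hpinL I hI g hg).2 p q

end Landau

end Summit.QuantumFields.YangMills.Theorems.AllWindowsColdBox.HodgeForm
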